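import Mathlib.Topology.Algebra.InfiniteSum.Basic
import Mathlib.Topology.Instances.ENNReal.Lemmas
import Literature.Probability.LatticeModels.IsingThermodynamics
import HarnessLib

/-!
# Divergence of the bubble diagram of the nearest-neighbour Ising model on `ℤ³` and `ℤ⁴`
# at criticality (Duminil-Copin–Panis 2025, Theorem 1.8)

Topic `Literature/Probability/LatticeModels`; a named fact (result in print, `def … : Prop`,
D-0014) requested as a STANDALONE Literature statement by the route
`Summit.CriticalPhenomena.….Theses.EnergyNotSigmaSquared` (items `RungOneAdjacentMerging`,
`FatnessLite`: the sum of `⟨σ₀σ_x⟩²_{β_c}` over dyadic shells is unbounded; work item `wi-14215`).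
So far the statement existed in the tree only as conjunct (N1) of the barrier
`Literature.Barriers.CriticalPhenomena.LaceExpansionIsingAboveFourNarrow`
(`LaceExpansionIsingAboveFour.lean`), whose `NNIsing.bubbleDiagram d β` is, verbatim,
`∑' x : Site d, ENNReal.ofReal (twoPointFree d β x) ^ 2` — the expression used below (this file
does not import the barrier catalogue; the two agree by `rfl`).

**What is printed.**  H. Duminil-Copin, R. Panis, *New lower bounds for the (near) critical Ising
and φ⁴ models' two-point functions*, Comm. Math. Phys. 406 (2025) (arXiv:2404.05700), §1: the
nearest-neighbour Ising model on `ℤ^d`, `d ≥ 3`, finite-volume measures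
`⟨F⟩_{Λ,β} ∝ ∫ F(τ) exp(β Σ_{x∼y} τ_xτ_y) ∏ dρ(τ_x)` with `ρ = ½(δ_{−1} + δ_1)` (no boundary term:
the free state), their weak limit `⟨·⟩_β` as `Λ ↑ ℤ^d`,
`β_c := inf{β ≥ 0 : χ(β) := Σ_x ⟨τ₀τ_x⟩_β = ∞}`, and the bubble diagram
`B(β) := Σ_{x∈ℤ^d} ⟨τ₀τ_x⟩_β²`;

> **Theorem 1.8 (Divergence of the bubble diagram).** Let `d = 3, 4`. Then `B(β_c) = ∞`.

(Proof by contradiction from the lower bound of Thm. 1.3 and the Messager–Miracle-Solé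
inequalities; Remark 1.9 gives the rate `B_n(β_c) ≥ c√(log n)` at `d = 3`.  For `d = 2` the
divergence follows from Simon's inequality, `d ≥ 5` has `B(β_c) < ∞` by the infrared bound — both
outside this theorem.)

* `DuminilCopinPanis2025_bubbleDiagram_eq_top` — Theorem 1.8 for the nearest-neighbour Ising
  model, both printed dimensions, over the tree's free-state two-point function
  `twoPointFree d β x = ⟨σ₀σ_x⟩^∅_{β,0}` and `criticalBeta d` (`IsingThermodynamics.lean`).
* API: the two dimensions separately (`….three`, `….four`), and the "not square-summable"
  reading (`….not_lt_top_three`).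

## Rendering

`⟨τ₀τ_x⟩_{β}` in the free infinite-volume state is the tree's `twoPointFree d β x`
(Friedli–Velenik §3.7.4 conventions; the weak limit of the free finite-volume states along boxes);
`B(β) = Σ_x ⟨σ₀σ_x⟩² ∈ [0, ∞]` is the `ℝ≥0∞`-valued `tsum` of `(ENNReal.ofReal ⟨σ₀σ_x⟩)²`
(summands in `[0,1]` by Griffiths' first inequality, so `ofReal` loses nothing: for the
nonnegative two-point function this is exactly the printed `Σ_x ⟨σ₀σ_x⟩²`).  The paper's
`β_c = inf{β : χ(β) = ∞}` is the susceptibility threshold; the tree's `criticalBeta d` is the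
magnetisation threshold `inf{β ≥ 0 : m*(β) > 0}`, equal to it for the nearest-neighbour model in
`d ≥ 2` by sharpness/continuity (Aizenman–Barsky–Fernández 1987, Aizenman–Duminil-Copin–Sidoravicius
2015; in tree `criticalBeta_eq_sSup_susceptibility_finite`, `Sharpness.lean`, with its discharge) —
the same identification the barrier file makes.  The normalisation of `β` (the paper sums over
neighbouring pairs) does not enter: the statement concerns the model at its own critical point.
Only the Ising case of the theorem is transcribed (the source also covers `φ⁴`).

## Mathlib / tree search

Tree: `twoPointFree`, `susceptibility`, `criticalBeta` (`IsingThermodynamics.lean`),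
`criticalBeta_eq_sSup_susceptibility_finite` (`Sharpness.lean`), the barrier conjunct
`LaceExpansionIsingAboveFourNarrow.bubbleDiagram_three_eq_top` and `NNIsing.bubbleDiagram`
(`Literature/Barriers/CriticalPhenomena/LaceExpansionIsingAboveFour.lean`), Simon-type `d = 2`
divergence proved there (`NNIsing.bubbleCondition_two_iff_false`).  No standalone Literature
statement of Theorem 1.8 (`lean search 'bubbleDiagram|DuminilCopinPanis'`).

## References

* H. Duminil-Copin, R. Panis, Comm. Math. Phys. 406 (2025), arXiv:2404.05700, §1 (model,
  `β_c`, (1.x) definition of `B(β)`), Theorem 1.8, Remark 1.9. [`DuminilCopinPanis2025LowerBounds`]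
* M. Aizenman, *Geometric analysis of φ⁴ fields and Ising models*, CMP 86 (1982) (the bubble
  diagram). [cited through the above]
-/

noncomputable section

open scoped ENNReal

namespace Literature.Probability.LatticeModels

/-- **Duminil-Copin–Panis 2025, Theorem 1.8 (divergence of the bubble diagram).**  "Let
`d = 3, 4`. Then `B(β_c) = ∞`", `B(β) := Σ_{x∈ℤ^d} ⟨τ₀τ_x⟩_β²`, for the nearest-neighbour Ising
model on `ℤ^d` in its (free) infinite-volume state at `β_c = inf{β ≥ 0 : χ(β) = ∞}`.  Rendered
(module docstring) over the tree's `twoPointFree d β x = ⟨σ₀σ_x⟩^∅_{β,0}` and `criticalBeta d`,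
the sum valued in `[0, ∞]`:
`Σ'_{x : ℤ³} (⟨σ₀σ_x⟩^∅_{β_c(3)})² = ∞` and `Σ'_{x : ℤ⁴} (⟨σ₀σ_x⟩^∅_{β_c(4)})² = ∞`
(each summand `ENNReal.ofReal (twoPointFree d (criticalBeta d) x) ^ 2`; this is verbatim
`NNIsing.bubbleDiagram d (criticalBeta d)` of the barrier catalogue).
[cite: DuminilCopinPanis2025LowerBounds, Theorem 1.8] -/
def DuminilCopinPanis2025_bubbleDiagram_eq_top : Prop :=
  (∑' x : Site 3, ENNReal.ofReal (twoPointFree 3 (criticalBeta 3) x) ^ 2 = ∞) ∧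
    (∑' x : Site 4, ENNReal.ofReal (twoPointFree 4 (criticalBeta 4) x) ^ 2 = ∞)

namespace DuminilCopinPanis2025_bubbleDiagram_eq_top

/-- Theorem 1.8 at `d = 3`: `B(β_c(3)) = Σ_x ⟨σ₀σ_x⟩²_{β_c} = ∞` for the nearest-neighbour Ising
model on `ℤ³`. [cite: DuminilCopinPanis2025LowerBounds, Theorem 1.8] -/
theorem three (h : DuminilCopinPanis2025_bubbleDiagram_eq_top) :
    ∑' x : Site 3, ENNReal.ofReal (twoPointFree 3 (criticalBeta 3) x) ^ 2 = ∞ :=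
  h.1

/-- Theorem 1.8 at `d = 4`: `B(β_c(4)) = ∞` on `ℤ⁴` (logarithmic divergence, Remark 1.9).
[cite: DuminilCopinPanis2025LowerBounds, Theorem 1.8] -/
theorem four (h : DuminilCopinPanis2025_bubbleDiagram_eq_top) :
    ∑' x : Site 4, ENNReal.ofReal (twoPointFree 4 (criticalBeta 4) x) ^ 2 = ∞ :=
  h.2

/-- The bubble CONDITION fails on `ℤ³`: the critical two-point function is not square-summable
(`Σ_x ⟨σ₀σ_x⟩²_{β_c} < ∞` is false). [cite: DuminilCopinPanis2025LowerBounds, Theorem 1.8] -/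
theorem not_lt_top_three (h : DuminilCopinPanis2025_bubbleDiagram_eq_top) :
    ¬ (∑' x : Site 3, ENNReal.ofReal (twoPointFree 3 (criticalBeta 3) x) ^ 2 < ∞) := by
  rw [h.1]
  exact lt_irrefl _

/-- Unboundedness of the partial sums: for every finite bound `M < ∞` some finite set of sites
already carries bubble mass `> M` (the form in which shell-by-shell lower bounds are extracted:
`tsum` in `ℝ≥0∞` is the supremum of the finite partial sums).
[cite: DuminilCopinPanis2025LowerBounds, Theorem 1.8] -/
theorem exists_finset_sum_gt_three (h : DuminilCopinPanis2025_bubbleDiagram_eq_top)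
    {M : ℝ≥0∞} (hM : M < ∞) :
    ∃ s : Finset (Site 3), M < ∑ x ∈ s, ENNReal.ofReal (twoPointFree 3 (criticalBeta 3) x) ^ 2 := by
  have htop := h.1
  rw [ENNReal.tsum_eq_iSup_sum] at htop
  by_contra hcon
  push Not at hcon
  have hle : (⨆ s : Finset (Site 3),
      ∑ x ∈ s, ENNReal.ofReal (twoPointFree 3 (criticalBeta 3) x) ^ 2) ≤ M := iSup_le hcon
  rw [htop] at hle
  exact (lt_irrefl _) (lt_of_le_of_lt hle hM)

end DuminilCopinPanis2025_bubbleDiagram_eq_top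

end Literature.Probability.LatticeModels
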